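import Literature.AlgebraicGeometry.Frobenioids.FrobenioidRealification
import Literature.AlgebraicGeometry.Frobenioids.PerfectionUntrCommute
import HarnessLib

/-!
# Frobenioids I, Proposition 5.3 "In particular": the left square of the 1-commutative diagram, AT THE
# constructions (closer of the schema `PreFrobenioid.Prop53_diagram`)

Mochizuki, *The geometry of Frobenioids I: the general theory*, Kyushu J. Math. **62** (2008)
293–400, §5, Proposition 5.3 p. 103 ll. 20–30 [cite: MochizukiFrdI2008, Prop. 5.3 p.103]:
"In particular, if `C` is of Frobenius-isotropic type, then there is a natural 1-commutative diagram of
functors `C → C^istr → C^pf` (over) `C^un-tr → (C^un-tr)^pf → C^rlf` [where the functor `C → C^istr` is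
the isotropification functor of Proposition 1.9, (v); the remaining functors are the functors that arise
naturally from the construction of the 'unit-trivialization', 'perfection', and 'realification']."
(Proof, p. 103 ll. 34–36: "… follow immediately from the definitions and Theorem 5.2, (ii), (iv).")

PROOF-ONLY companion of `FrobenioidRealification.lean` (seat abc-iut-L1-t5; cell abc-iut, sub-DAG
`plan/L1/SUBDAG-FrdI-Prop53-Cor54.md` row P53/L05a).  The typed statement of record is the SCHEMA
`PreFrobenioid.Prop53_diagram F P SU PU` (parameters: a perfection datum `P` of `C`, operations `SU` and a
perfection datum `PU` of `C^un-tr`).  This file CLOSES it at THE constructions: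
`P := PreFrobenioidData.perfection hF` (THE `C^pf`, seat abc-iut-L1-d9), `SU := ofFunctor Φ (untrFunctor hF)`
(THE Frobenioid structure of `C^un-tr`, seat abc-iut-L1-d5), `PU := PreFrobenioidData.perfection
(isFrobenioid_untr hF)` (THE `(C^un-tr)^pf`).

The vertical arrow `C^pf → (C^un-tr)^pf`.  Print's arrow "arises naturally from the construction of the
perfection" of `C^istr → C^un-tr`; since the objects of `C^un-tr` are the ISOTROPIC objects of `C`, a functor out
of the whole of `C^pf` requires print's standing reduction "WLOG `C` is of isotropic type" (for `C` of
Frobenius-isotropic type `(C^istr)^pf → C^pf` is an equivalence: `(A, n) ≅ (A^{(d)}, n·d)`), exactly as in the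
proof of Prop. 5.5 (ii) (seat abc-iut-w5-d026, `PerfectionUntrCommute.lean`).  Accordingly the arrow is
`I⁻¹ ⋙ U` with `I = ι^pf : (C^istr)^pf → C^pf` (`PerfectionUntr.inclMap`, an equivalence by
`inclMap_full/_faithful/_essSurj` — `Prop53Diagram.inclMap_isEquivalence`) and `U = j^pf : (C^istr)^pf →
(C^un-tr)^pf` (`PerfectionUntr.untrMap`), and the square `(C^istr ⊆ C → C^pf) ⋙ I⁻¹ ⋙ U ≅ (C^istr → C^un-tr →
(C^un-tr)^pf)` (`Prop53Diagram.nonempty_squareIso`) is assembled from the two 1-compatibility squares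
`toPf ⋙ G^pf ≅ G ⋙ toPf` of the perfection functoriality (`Perfection.toPfCompMapIso`, seat abc-iut-L1-d9) and
the unit `𝟭 ≅ I ⋙ I⁻¹`.  The only bookkeeping is the identity-on-objects bridge between the two renderings of
`C^istr` in the tree (`(ofFunctor Φ F).Istr`, over which the schema is typed, and `Istr F`, over which `I`, `U`
are built), an isomorphism ON THE NOSE with both `C^istr ⊆ C` and `C^istr → C^un-tr`.  PROOF-ONLY (theorems;
no definition is introduced — a NAMED functor `C^pf → (C^un-tr)^pf`, if a consumer wants one, is the term
`(PerfectionUntr.inclMap hF).inv ⋙ PerfectionUntr.untrMap hF` displayed in `nonempty_squareIso`).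

No statement of the paper is strengthened; the hypothesis "Frobenius-isotropic type" is used (essential
surjectivity of `I`).  Nothing here bears on [IUTchIII] Cor. 3.12.
-/

namespace Literature.AlgebraicGeometry.Frobenioids

namespace PreFrobenioid

open CategoryTheory Opposite

universe w v v' u u'

variable {D : Type u} [Category.{v} D] {Φ : Dᵒᵖ ⥤ CommMonCat.{w}}
  {C : Type u'} [Category.{v'} C] {F : C ⥤ ElemFrobenioid Φ}

open PreFrobenioidData (ofFunctor)

namespace Prop53Diagram

/-- For `C` of Frobenius-isotropic type, `I = ι^pf : (C^istr)^pf → C^pf` is an equivalence of categories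
(full, faithful, essentially surjective — seat abc-iut-w5-d026). [cite: MochizukiFrdI2008, Prop. 5.5 (ii) p.105] -/
theorem inclMap_isEquivalence (hF : IsFrobenioid F) (hiso : IsOfType (IsFrobeniusIsotropic F)) :
    (PerfectionUntr.inclMap hF).IsEquivalence :=
  haveI := PerfectionUntr.inclMap_faithful (hF := hF)
  haveI := PerfectionUntr.inclMap_full (hF := hF)
  haveI := PerfectionUntr.inclMap_essSurj (hF := hF) hiso
  { }

/-- **The left square of the diagram of Prop. 5.3 1-commutes, for THE vertical arrow `I⁻¹ ⋙ U`**: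
`(C^istr ⊆ C → C^pf) ⋙ I⁻¹ ⋙ U ≅ (C^istr → C^un-tr → (C^un-tr)^pf)`, where `I = ι^pf : (C^istr)^pf ⥲ C^pf`
(print's "WLOG isotropic") and `U = j^pf : (C^istr)^pf → (C^un-tr)^pf`; assembled from the two squares
`toPf ⋙ G^pf ≅ G ⋙ toPf` of the perfection functoriality and the unit `𝟭 ≅ I ⋙ I⁻¹`, after the
identity-on-objects bridge `(ofFunctor Φ F).Istr ⥤ Istr F` (an isomorphism on the nose with both `C^istr ⊆ C`
and `C^istr → C^un-tr`). [cite: MochizukiFrdI2008, Prop. 5.3 p.103] -/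
theorem nonempty_squareIso (hF : IsFrobenioid F) (hiso : IsOfType (IsFrobeniusIsotropic F)) :
    Nonempty ((ofFunctor Φ F).istrι ⋙ Perfection.toPf hF ⋙
        @Functor.inv _ _ _ _ (PerfectionUntr.inclMap hF) (inclMap_isEquivalence hF hiso) ⋙
          PerfectionUntr.untrMap hF ≅
      (ofFunctor Φ F).toUntr ⋙ Perfection.toPf (isFrobenioid_untr hF)) := by
  haveI := inclMap_isEquivalence hF hiso
  -- the bridge between the two renderings of `C^istr`, and its two on-the-nose compatibilities
  let B : (ofFunctor Φ F).Istr ⥤ Istr F := ObjectProperty.ιOfLE (isotropicObjects_ofFunctor_le F)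
  let eι : B ⋙ (isotropicObjects F).ι ≅ (ofFunctor Φ F).istrι := Iso.refl _
  let ej : B ⋙ istrToUntr F ≅ (ofFunctor Φ F).toUntr :=
    NatIso.ofComponents (fun _ => Iso.refl _) (fun _ => (Category.comp_id _).trans (Category.id_comp _).symm)
  exact ⟨calc (ofFunctor Φ F).istrι ⋙ Perfection.toPf hF ⋙ (PerfectionUntr.inclMap hF).inv ⋙
        PerfectionUntr.untrMap hF
    _ ≅ (B ⋙ (isotropicObjects F).ι) ⋙ Perfection.toPf hF ⋙ (PerfectionUntr.inclMap hF).inv ⋙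
          PerfectionUntr.untrMap hF :=
        Functor.isoWhiskerRight eι.symm _
    _ ≅ B ⋙ ((isotropicObjects F).ι ⋙ Perfection.toPf hF) ⋙ (PerfectionUntr.inclMap hF).inv ⋙
          PerfectionUntr.untrMap hF :=
        Iso.refl _
    _ ≅ B ⋙ (Perfection.toPf (isFrobenioid_istr hF) ⋙ PerfectionUntr.inclMap hF) ⋙
          (PerfectionUntr.inclMap hF).inv ⋙ PerfectionUntr.untrMap hF :=
        Functor.isoWhiskerLeft _ (Functor.isoWhiskerRight
          (Perfection.toPfCompMapIso (hF₁ := isFrobenioid_istr hF) (hF₂ := hF)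
            (isFrobeniusCompatible_istrι hF)).symm _)
    _ ≅ B ⋙ Perfection.toPf (isFrobenioid_istr hF) ⋙
          (PerfectionUntr.inclMap hF ⋙ (PerfectionUntr.inclMap hF).inv) ⋙ PerfectionUntr.untrMap hF :=
        Iso.refl _
    _ ≅ B ⋙ Perfection.toPf (isFrobenioid_istr hF) ⋙ 𝟭 _ ⋙ PerfectionUntr.untrMap hF :=
        Functor.isoWhiskerLeft _ (Functor.isoWhiskerLeft _ (Functor.isoWhiskerRight
          (PerfectionUntr.inclMap hF).asEquivalence.unitIso.symm _))
    _ ≅ B ⋙ Perfection.toPf (isFrobenioid_istr hF) ⋙ PerfectionUntr.untrMap hF :=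
        Functor.isoWhiskerLeft _ (Functor.isoWhiskerLeft _ (Functor.leftUnitor _))
    _ ≅ B ⋙ istrToUntr F ⋙ Perfection.toPf (isFrobenioid_untr hF) :=
        Functor.isoWhiskerLeft _
          (Perfection.toPfCompMapIso (hF₁ := isFrobenioid_istr hF) (hF₂ := isFrobenioid_untr hF)
            (isFrobeniusCompatible_istrToUntr hF))
    _ ≅ (B ⋙ istrToUntr F) ⋙ Perfection.toPf (isFrobenioid_untr hF) := Iso.refl _
    _ ≅ (ofFunctor Φ F).toUntr ⋙ Perfection.toPf (isFrobenioid_untr hF) :=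
        Functor.isoWhiskerRight ej _⟩

/-- **The left square of the diagram of Prop. 5.3, existence form**: for `C` of Frobenius-isotropic type
there is a functor `C^pf → (C^un-tr)^pf` (namely `I⁻¹ ⋙ U`) under which `C^istr ⊆ C → C^pf → (C^un-tr)^pf` is
isomorphic to `C^istr → C^un-tr → (C^un-tr)^pf`. [cite: MochizukiFrdI2008, Prop. 5.3 p.103] -/
theorem exists_pfUntr_squareIso (hF : IsFrobenioid F) (hiso : IsOfType (IsFrobeniusIsotropic F)) :
    ∃ pfUntr : Perfection hF ⥤ Perfection (isFrobenioid_untr hF),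
      Nonempty ((ofFunctor Φ F).istrι ⋙ Perfection.toPf hF ⋙ pfUntr ≅
        (ofFunctor Φ F).toUntr ⋙ Perfection.toPf (isFrobenioid_untr hF)) :=
  ⟨_, nonempty_squareIso hF hiso⟩

end Prop53Diagram

/-! ### The closer of the schema `Prop53_diagram` -/

/-- **[FrdI] Prop. 5.3, "In particular" — the left square of the 1-commutative diagram, AT THE
constructions**: seat abc-iut-L1-t5's typed schema `PreFrobenioid.Prop53_diagram F P SU PU` holds for
`P :=` THE perfection datum of `C`, `SU :=` THE Frobenioid structure `untrFunctor hF` of `C^un-tr` (operations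
form), `PU :=` THE perfection datum of `C^un-tr`: for `C` of Frobenius-isotropic type there is a functor
`C^pf → (C^un-tr)^pf` (namely `I⁻¹ ⋙ U`, `Prop53Diagram.nonempty_squareIso`) making the square with
`C^istr ⊆ C → C^pf` and `C^istr → C^un-tr → (C^un-tr)^pf` 1-commute. [cite: MochizukiFrdI2008, Prop. 5.3 p.103] -/
theorem prop53_diagram_holds (hF : IsFrobenioid F) :
    Literature.AlgebraicGeometry.Frobenioids.PreFrobenioid.Prop53_diagram F
      (Literature.AlgebraicGeometry.Frobenioids.PreFrobenioidData.perfection hF)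
      (Literature.AlgebraicGeometry.Frobenioids.PreFrobenioidData.ofFunctor Φ (untrFunctor hF))
      (Literature.AlgebraicGeometry.Frobenioids.PreFrobenioidData.perfection (isFrobenioid_untr hF)) :=
  fun _ hiso => Prop53Diagram.exists_pfUntr_squareIso hF hiso

end PreFrobenioid

end Literature.AlgebraicGeometry.Frobenioids
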